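import Literature.MathematicalPhysics.QuantumLattice.KohnLuttingerChannelStates
import HarnessLib

/-!
# The coset decomposition of the `D₄` isotypic projections (saddle stabiliser vs nesting coset)

Topic `Literature/MathematicalPhysics/QuantumLattice`; continues `KohnLuttingerChannelStates`.
The stabiliser of the van Hove saddle `s₁ = (π, 0)` in `D₄` (momenta mod `2π`) is the Klein group
`D₂ = {1, r², s, s r²}`; the other coset `{r, r³, s r, s r³}` maps `s₁` to `± s₂ = ± (0, π)`, i.e. for `k, k'`
near `s₁` the momenta `k + γ k'` lie near `2 s₁ ≡ 0` for `γ ∈ D₂` and near the NESTING vector `Q = s₁ + s₂`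
otherwise.  Splitting the sum `∑_γ χ(γ) ψ(γ k)` defining `d4Project χ ψ k` (`KohnLuttinger.lean`) along the two
cosets, with and without the reflection sign, gives four coset sums `S₊, S₋, N₊, N₋` and the exact identities

* `d4Project_A1g_eq_cosets : P_{A₁g} ψ k = (S₊ + N₊)/8`, `d4Project_B1g_eq_cosets : P_{B₁g} ψ k = (S₊ - N₊)/8`,
  `d4Project_A2g_eq_cosets : P_{A₂g} ψ k = (S₋ + N₋)/8`, `d4Project_B2g_eq_cosets : P_{B₂g} ψ k = (S₋ - N₋)/8`,
  `d4Project_E_eq_odd_part : P_E ψ k = (ψ k - ψ (-k))/2` (the `E` projection never involves the nesting coset);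
* `d4Project_A2g_sub_B2g : P_{A₂g} ψ k - P_{B₂g} ψ k = N₋/4` and `d4Project_A1g_sub_B1g : P_{A₁g} ψ k - P_{B₁g} ψ k = N₊/4`.

Applied to `ψ = χ₀(k + ·)` these are the sector kernels of the second-order Kohn–Luttinger vertex: the
`B₁g - A₁g` splitting is the unsigned nesting sum, the `A₂g - B₂g` splitting the reflection-signed one
(Raghu–Kivelson–Scalapino 2010 §III: the two-patch mechanism is the `k = k' = s₁` value of these identities).
Everything is proved; the four definitions are abbreviations of finite sums. [folklore]
-/

noncomputable section

open Real

namespace Literature.MathematicalPhysics.QuantumLattice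

/-- Unsigned sum over the saddle-stabiliser coset `D₂ = {1, r², s, s r²}`:
`S₊ ψ k = ψ(k) + ψ(r² k) + ψ(s k) + ψ(s r² k)`. [folklore] -/
def d4StabSum (ψ : Momentum → ℝ) (k : Momentum) : ℝ :=
  ψ (d4Momentum (.r 0) k) + ψ (d4Momentum (.r 2) k) + ψ (d4Momentum (.sr 0) k) + ψ (d4Momentum (.sr 2) k)

/-- Reflection-signed sum over the saddle-stabiliser coset:
`S₋ ψ k = ψ(k) + ψ(r² k) - ψ(s k) - ψ(s r² k)`. [folklore] -/
def d4StabSumSigned (ψ : Momentum → ℝ) (k : Momentum) : ℝ :=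
  ψ (d4Momentum (.r 0) k) + ψ (d4Momentum (.r 2) k) - ψ (d4Momentum (.sr 0) k) - ψ (d4Momentum (.sr 2) k)

/-- Unsigned sum over the nesting coset `{r, r³, s r, s r³}`:
`N₊ ψ k = ψ(r k) + ψ(r³ k) + ψ(s r k) + ψ(s r³ k)`. [folklore] -/
def d4NestSum (ψ : Momentum → ℝ) (k : Momentum) : ℝ :=
  ψ (d4Momentum (.r 1) k) + ψ (d4Momentum (.r 3) k) + ψ (d4Momentum (.sr 1) k) + ψ (d4Momentum (.sr 3) k)

/-- Reflection-signed sum over the nesting coset: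
`N₋ ψ k = ψ(r k) + ψ(r³ k) - ψ(s r k) - ψ(s r³ k)`. [folklore] -/
def d4NestSumSigned (ψ : Momentum → ℝ) (k : Momentum) : ℝ :=
  ψ (d4Momentum (.r 1) k) + ψ (d4Momentum (.r 3) k) - ψ (d4Momentum (.sr 1) k) - ψ (d4Momentum (.sr 3) k)

/-- The `ZMod 4` inequalities used to evaluate the character table. [folklore] -/
private theorem zmod4_facts : (1 : ZMod 4) ≠ 0 ∧ (1 : ZMod 4) ≠ 2 ∧ (2 : ZMod 4) ≠ 0 ∧
    (3 : ZMod 4) ≠ 0 ∧ (3 : ZMod 4) ≠ 2 := by decide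

/-- **`A₁g` projection = (stabiliser sum + nesting sum)/8.** [cite: RaghuKivelsonScalapino2010, §III (17)] -/
theorem d4Project_A1g_eq_cosets (ψ : Momentum → ℝ) (k : Momentum) :
    d4Project .A1g ψ k = (d4StabSum ψ k + d4NestSum ψ k) / 8 := by
  simp only [d4Project, sum_dihedralGroup_four, D4Irrep.char, D4Irrep.dim, d4StabSum, d4NestSum]
  norm_num; ring

/-- **`B₁g` projection = (stabiliser sum − nesting sum)/8.** [cite: RaghuKivelsonScalapino2010, §III (17)] -/
theorem d4Project_B1g_eq_cosets (ψ : Momentum → ℝ) (k : Momentum) :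
    d4Project .B1g ψ k = (d4StabSum ψ k - d4NestSum ψ k) / 8 := by
  simp only [d4Project, sum_dihedralGroup_four, D4Irrep.char, D4Irrep.dim, zmod_four_val.1,
    zmod_four_val.2.1, zmod_four_val.2.2.1, zmod_four_val.2.2.2, d4StabSum, d4NestSum]
  norm_num; ring

/-- **`A₂g` projection = (signed stabiliser sum + signed nesting sum)/8.** [cite: RaghuKivelsonScalapino2010, §III (17)] -/
theorem d4Project_A2g_eq_cosets (ψ : Momentum → ℝ) (k : Momentum) :
    d4Project .A2g ψ k = (d4StabSumSigned ψ k + d4NestSumSigned ψ k) / 8 := by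
  simp only [d4Project, sum_dihedralGroup_four, D4Irrep.char, D4Irrep.dim, d4StabSumSigned, d4NestSumSigned]
  norm_num; ring

/-- **`B₂g` projection = (signed stabiliser sum − signed nesting sum)/8.** [cite: RaghuKivelsonScalapino2010, §III (17)] -/
theorem d4Project_B2g_eq_cosets (ψ : Momentum → ℝ) (k : Momentum) :
    d4Project .B2g ψ k = (d4StabSumSigned ψ k - d4NestSumSigned ψ k) / 8 := by
  simp only [d4Project, sum_dihedralGroup_four, D4Irrep.char, D4Irrep.dim, zmod_four_val.1,
    zmod_four_val.2.1, zmod_four_val.2.2.1, zmod_four_val.2.2.2, d4StabSumSigned, d4NestSumSigned]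
  norm_num; ring

/-- `r²` acts as the inversion `k ↦ -k`. [cite: RaghuKivelsonScalapino2010, §III (17)] -/
theorem d4Momentum_r_two_eq_neg (k : Momentum) : d4Momentum (.r 2) k = -k := by
  ext j
  fin_cases j <;> simp [d4Momentum_r_two]

/-- **The `E` projection is the odd part: `P_E ψ k = (ψ k − ψ (−k))/2`** — it never involves the nesting
coset (so the `E` sector kernel of `χ₀(k + ·)` contains no `χ₀(· + Q)`-type term). [cite: RaghuKivelsonScalapino2010, §III (17)] -/
theorem d4Project_E_eq_odd_part (ψ : Momentum → ℝ) (k : Momentum) :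
    d4Project .E ψ k = (ψ k - ψ (-k)) / 2 := by
  obtain ⟨z10, z12, z20, z30, z32⟩ := zmod4_facts
  rw [← d4Momentum_r_two_eq_neg k]
  simp only [d4Project, sum_dihedralGroup_four, D4Irrep.char, D4Irrep.dim, z10, z12, z20, z30, z32,
    if_true, if_false, d4Momentum_r_zero]
  norm_num; ring

/-- **The signed nesting sum is the `A₂g − B₂g` splitting:** `P_{A₂g} ψ k − P_{B₂g} ψ k = N₋ ψ k / 4`. [cite: RaghuKivelsonScalapino2010, §III (17)] -/
theorem d4Project_A2g_sub_B2g (ψ : Momentum → ℝ) (k : Momentum) :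
    d4Project .A2g ψ k - d4Project .B2g ψ k = d4NestSumSigned ψ k / 4 := by
  rw [d4Project_A2g_eq_cosets, d4Project_B2g_eq_cosets]; ring

/-- **The unsigned nesting sum is the `A₁g − B₁g` splitting:** `P_{A₁g} ψ k − P_{B₁g} ψ k = N₊ ψ k / 4`. [cite: RaghuKivelsonScalapino2010, §III (17)] -/
theorem d4Project_A1g_sub_B1g (ψ : Momentum → ℝ) (k : Momentum) :
    d4Project .A1g ψ k - d4Project .B1g ψ k = d4NestSum ψ k / 4 := by
  rw [d4Project_A1g_eq_cosets, d4Project_B1g_eq_cosets]; ring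

end Literature.MathematicalPhysics.QuantumLattice

end
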